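import Mathlib
import HarnessLib
import Summits.Ventures.LatticeQCDFlow.Exactness.U1LeapfrogHMCErgodic
import Summits.Ventures.LatticeQCDFlow.Exactness.U1ExpChartMinorisation
import Summits.Ventures.LatticeQCDFlow.Exactness.LipschitzDilationMinorisation

/-!
# Doeblin and uniform ergodicity for ANY `U(1)` HMC proposal whose configuration is one drift of a Lipschitz-small perturbation of a dilation

HONEST FRAMING: exact (Metropolis-corrected) sampling algorithms for lattice gauge theory;
figures of merit are autocorrelation/cost numbers at stated couplings and volumes; no
continuum-physics claim.

Venture `LatticeQCDFlow` (cell pub-lqcd), topic `Exactness`, FANOUT row 14 (`eng-flowhmc`, engine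
`latflow.fthmc`, family B, `U(1)` rung, every integrator word and every `n_md`).  NEW WORK of the
cell over row 9's `U1LeapfrogHMC.lean` / `U1LeapfrogHMCErgodic.lean` (momentum law, Gaussian-on-a-box
minorant, Gibbs law), `U1ExpChartMinorisation.lean` (one link: `(2π/ε) • Haar ≤` Lebesgue on
`(−π/ε, π/ε)` through `θ ↦ e^{iεθ}·u`), `LeapfrogHMCDoeblin.lean` (`refreshUpdate_involMH_minorised`,
`smul_pi_le_pi`, the uniform-ergodicity / uniqueness readings), `MomentumRefresh.lean`
(`hmc_config_exact`) and this row's `LipschitzDilationMinorisation.lean`; nothing is cited as a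
fact; no number.

THE INTEGRATOR-INDEPENDENT DOEBLIN CORE.  `Ψ` is ANY measurable proposal on `U(1)^ι × (ι → ℝ)`
(in practice `flip ∘ wordⁿ` for a palindromic kick/drift word) such that, from every configuration
`u`, the proposed CONFIGURATION is one drift `e₁(a • p + G_u p) · u` of a perturbed dilation of the
momentum — `a > 0`, `‖G_u‖ ≤ B₀`, `G_u` `λ`-Lipschitz with `λ < a`, uniformly in `u` — and the
proposed MOMENTUM has `‖(Ψ(u,p)).2‖ ≤ ‖p‖ + M` (both delivered by `U1NearFreeFlight.nearFreeFlight_iterate_fst/snd`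
for words, by `U1LeapfrogTrajectory.exists_u1Leapfrog_pow_fst` for leapfrog).  Then for every
measurable action `|S| ≤ s` and `κ > 0`:

* `u1Word_energy_window` — `H(Ψ(u,p)) ≤ H(u,p) + 2s + κ|ι|(R + M)²` on `‖p‖ ≤ R`;
* `smul_pi_haar_le_map_u1ExpDrift_one_mul` — one unit drift of ball-uniform momenta of radius `π`
  dominates `(2π)^{|ι|} •` product Haar, from every `u`;
* **`u1Word_minorised`** — DOEBLIN: `∃ δ > 0, ∀ u, K(u, ·) ≥ δ · Haar^{⊗ι}` for the kernel
  `refreshUpdate (involMH Ψ _ (S + T_κ)) (u1MomentumLaw κ)`;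
* `u1Word_invariant_gibbsLaw` — if `Ψ` is an involution preserving `Haar^{⊗ι} ⊗ Lebesgue` the kernel
  leaves `π_S` invariant (exactness, `hmc_config_exact`);
* **`u1Word_uniformlyErgodic`**, **`u1Word_invariant_unique`** — with that invariance:
  `|μ₀Kᵗ(A) − π_S(A)| ≤ (1 − δ)ᵗ` from EVERY initial law, and `π_S` is the only invariant
  probability law.

NOT here: which words satisfy the hypothesis (leapfrog: `U1LeapfrogTrajectory`; OMF2 and general
words: `U1NearFreeFlight` + `U1Omf2MultiStepErgodic`); `SU(2)`; any usable `δ`; floating point.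
-/

noncomputable section

namespace Summit.Ventures.LatticeQCDFlow.Exactness

open MeasureTheory ProbabilityTheory ProbabilityTheory.Kernel Set Metric
open Literature.MathematicalPhysics.QuantumFieldTheory (haarProbability)
open scoped ENNReal NNReal

variable {ι : Type*} [Fintype ι] {κ : ℝ}

/-! ## §1 The energy window and the one-drift chart bound -/

/-- **Energy window**: if the proposed momentum satisfies `‖(Ψ(u,p)).2‖ ≤ ‖p‖ + M` then for
`‖p‖ ≤ R` and `|S| ≤ s`, `H(Ψ(u, p)) ≤ H(u, p) + 2s + κ|ι|(R + M)²`. -/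
theorem u1Word_energy_window {Ψ : (ι → Circle) × (ι → ℝ) → (ι → Circle) × (ι → ℝ)} (hκ : 0 ≤ κ)
    {M : ℝ} (hsnd : ∀ u p, ‖(Ψ (u, p)).2‖ ≤ ‖p‖ + M)
    {S : (ι → Circle) → ℝ} {s : ℝ} (hs : ∀ u, |S u| ≤ s) {R : ℝ}
    (u : ι → Circle) {p : ι → ℝ} (hp : ‖p‖ ≤ R) :
    (fun z : (ι → Circle) × (ι → ℝ) => S z.1 + u1Kinetic κ z.2) (Ψ (u, p)) ≤
      (fun z : (ι → Circle) × (ι → ℝ) => S z.1 + u1Kinetic κ z.2) (u, p) +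
        (2 * s + κ * (Fintype.card ι * (R + M) ^ 2)) := by
  dsimp only
  have h1 : S (Ψ (u, p)).1 ≤ s := (abs_le.1 (hs _)).2
  have h2 : -s ≤ S u := (abs_le.1 (hs u)).1
  have h3 : 0 ≤ u1Kinetic κ p := u1Kinetic_nonneg hκ p
  have h4 : u1Kinetic κ (Ψ (u, p)).2 ≤ κ * (Fintype.card ι * (R + M) ^ 2) :=
    u1Kinetic_le_of_norm_le hκ fun l => (norm_le_pi_norm _ l).trans ((hsnd u p).trans (by linarith))
  linarith

/-- **One unit drift of ball-uniform momenta (radius `π`, sup norm) dominates `(2π)^{|ι|} ·` product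
Haar measure**, from every configuration (link by link: row 9's
`smul_haarProbability_circle_le_map_kickDrift` with no kick; over the lattice: `smul_pi_le_pi`). -/
theorem smul_pi_haar_le_map_u1ExpDrift_one_mul (u : ι → Circle) :
    (ENNReal.ofReal (2 * Real.pi) ^ Fintype.card ι) •
        Measure.pi (fun _ : ι => haarProbability Circle) ≤
      (volume.restrict (ball (0 : ι → ℝ) Real.pi)).map (fun a => u1ExpDrift 1 a * u) := by
  classical
  haveI hfin : IsFiniteMeasure ((volume : Measure ℝ).restrict (ball (0 : ℝ) Real.pi)) :=
    ⟨by rw [Measure.restrict_apply_univ]; exact measure_ball_lt_top⟩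
  have hF : (fun a : ι → ℝ => u1ExpDrift 1 a * u) =
      fun a l => (fun (l : ι) (θ : ℝ) => Circle.exp (1 * (0 + θ)) * u l) l (a l) := by
    funext a l
    simp only [Pi.mul_apply, u1ExpDrift_apply, zero_add]
  have hball : ball (0 : ι → ℝ) Real.pi = Set.pi univ fun _ => ball (0 : ℝ) Real.pi := by
    rw [ball_pi _ Real.pi_pos]
    rfl
  rw [hF, hball, volume_pi, Measure.restrict_pi_pi,
    Measure.pi_map_pi (fun l => (measurable_circleKickDrift 1 0 (u l)).aemeasurable),
    ← Finset.card_univ, ← Finset.prod_const]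
  refine smul_pi_le_pi fun l => ?_
  have h := smul_haarProbability_circle_le_map_kickDrift one_pos (v := 0) (R := Real.pi)
    (by rw [norm_zero, add_zero, div_one]) (u l)
  rwa [div_one] at h

/-! ## §2 Doeblin -/

/-- **DOEBLIN FOR ANY `U(1)` HMC PROPOSAL WITH A ONE-DRIFT, LIPSCHITZ-SMALL CONFIGURATION MAP.**
`Ψ` measurable; from every `u` the proposed configuration is `e₁(a • p + G_u p) · u` with `a > 0`,
`‖G_u‖ ≤ B₀`, `G_u` `λ`-Lipschitz, `λ < a`; the proposed momentum has `‖(Ψ(u,p)).2‖ ≤ ‖p‖ + M`;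
`|S| ≤ s` measurable; `κ > 0`.  Then `∃ δ > 0` with `K(u, ·) ≥ δ · Haar^{⊗ι}` from EVERY `u`. -/
theorem u1Word_minorised {Ψ : Equiv.Perm ((ι → Circle) × (ι → ℝ))} (hΨ : Measurable ⇑Ψ)
    (hκ : 0 < κ) {a : ℝ} (ha : 0 < a) {lam : ℝ≥0} (hlam : (lam : ℝ) < a) {B₀ M : ℝ} (hM : 0 ≤ M)
    (hfst : ∀ u, ∃ G : (ι → ℝ) → ι → ℝ, (∀ p, ‖G p‖ ≤ B₀) ∧ LipschitzWith lam G ∧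
      ∀ p, (Ψ (u, p)).1 = u1ExpDrift 1 (a • p + G p) * u)
    (hsnd : ∀ u p, ‖(Ψ (u, p)).2‖ ≤ ‖p‖ + M)
    {S : (ι → Circle) → ℝ} (hS : Measurable S) {s : ℝ} (hs : ∀ u, |S u| ≤ s) :
    ∃ δ : ℝ≥0∞, 0 < δ ∧ ∀ u, δ • Measure.pi (fun _ : ι => haarProbability Circle) ≤
      refreshUpdate (involMH _ hΨ fun z : (ι → Circle) × (ι → ℝ) => S z.1 + u1Kinetic κ z.2)
        (u1MomentumLaw κ) u := by
  classical
  haveI : Fact (0 < κ) := ⟨hκ⟩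
  have hB0 : 0 ≤ B₀ := by
    obtain ⟨G, hG, -, -⟩ := hfst fun _ => 1
    exact (norm_nonneg _).trans (hG 0)
  set R : ℝ := (Real.pi + B₀) / a with hR
  have hR0 : 0 < R := div_pos (by positivity) ha
  set c : ℝ≥0∞ := (u1MomentumWeight (ι := ι) κ univ)⁻¹ *
    ENNReal.ofReal (Real.exp (-(κ * (Fintype.card ι * R ^ 2)))) with hc
  set BH : ℝ := 2 * s + κ * (Fintype.card ι * (R + M) ^ 2) with hBH
  set θ : ℝ≥0∞ := ENNReal.ofReal (2 * Real.pi) ^ Fintype.card ι with hθ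
  set Kc : ℝ≥0∞ := ENNReal.ofReal (a + lam) ^ Fintype.card ι with hKc
  have hH : Measurable fun z : (ι → Circle) × (ι → ℝ) => S z.1 + u1Kinetic κ z.2 :=
    (hS.comp measurable_fst).add ((measurable_u1Kinetic κ).comp measurable_snd)
  have hs0 : 0 ≤ s := (abs_nonneg _).trans (hs fun _ => 1)
  have hBH0 : 0 ≤ BH := by positivity
  have hKc0 : Kc ≠ 0 := pow_ne_zero _ (ENNReal.ofReal_pos.2 (by positivity)).ne'
  have hKctop : Kc ≠ ⊤ := ENNReal.pow_ne_top ENNReal.ofReal_ne_top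
  have hbox : u1MomBox (ι := ι) R = ball (0 : ι → ℝ) R := by
    rw [u1MomBox, ball_pi _ hR0]
    rfl
  refine ⟨ENNReal.ofReal (Real.exp (-BH)) * (c * (Kc⁻¹ * θ)), ?_, fun u => ?_⟩
  · refine ENNReal.mul_pos (ENNReal.ofReal_pos.2 (Real.exp_pos _)).ne'
      (mul_ne_zero (mul_ne_zero ?_ ?_) (mul_ne_zero ?_ ?_))
    · exact ENNReal.inv_ne_zero.2 (u1MomentumWeight_univ_ne_top hκ)
    · exact (ENNReal.ofReal_pos.2 (Real.exp_pos _)).ne'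
    · exact ENNReal.inv_ne_zero.2 hKctop
    · exact pow_ne_zero _ (ENNReal.ofReal_pos.2 (by positivity)).ne'
  · refine refreshUpdate_involMH_minorised hΨ hH (u1MomentumLaw κ)
      (ρ := c • volume.restrict (u1MomBox (ι := ι) R))
      (smul_restrict_u1MomBox_le_u1MomentumLaw hκ R)
      (fun v => Measure.ae_smul_measure ((ae_restrict_iff' (measurableSet_u1MomBox R)).2
        (Filter.Eventually.of_forall fun p hp => le_involAcceptE_of_le hBH0
          (u1Word_energy_window hκ.le hsnd hs v ?_))) _)
      (fun v => ?_) u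
    · rw [hbox, mem_ball_zero_iff] at hp
      exact hp.le
    · obtain ⟨G, hGb, hGL, hfstv⟩ := hfst v
      have hΦm : Measurable fun p : ι → ℝ => a • p + G p := (continuous_smul_add hGL).measurable
      have hD : Measurable fun q : ι → ℝ => u1ExpDrift 1 q * v := (measurable_u1ExpDrift 1).mul_const v
      -- (i) one drift of ball-uniform momenta dominates product Haar
      have h1 := smul_pi_haar_le_map_u1ExpDrift_one_mul (ι := ι) v
      -- (ii) ball-uniform momenta are dominated by the push-forward under `a • id + G`
      have h2 := restrict_ball_le_smul_map_smul_add ha hGL hlam hGb (R := R) (R' := Real.pi) le_rfl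
      -- (iii) compose
      have h3 := Measure.map_mono h2 hD
      rw [Measure.map_smul, Measure.map_map hD hΦm] at h3
      have hcomp : ((fun q : ι → ℝ => u1ExpDrift 1 q * v) ∘ fun p : ι → ℝ => a • p + G p) =
          fun p => (Ψ (v, p)).1 := funext fun p => (hfstv p).symm
      rw [hcomp] at h3
      have h4 : θ • Measure.pi (fun _ : ι => haarProbability Circle) ≤
          Kc • (volume.restrict (ball (0 : ι → ℝ) R)).map fun p => (Ψ (v, p)).1 := h1.trans h3
      have h5 : (Kc⁻¹ * θ) • Measure.pi (fun _ : ι => haarProbability Circle) ≤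
          (volume.restrict (ball (0 : ι → ℝ) R)).map fun p => (Ψ (v, p)).1 := by
        refine Measure.le_iff'.2 fun A => ?_
        have hA := Measure.le_iff'.1 h4 A
        simp only [Measure.smul_apply, smul_eq_mul] at hA ⊢
        calc Kc⁻¹ * θ * Measure.pi (fun _ : ι => haarProbability Circle) A
            = Kc⁻¹ * (θ * Measure.pi (fun _ : ι => haarProbability Circle) A) := mul_assoc _ _ _
          _ ≤ Kc⁻¹ * (Kc * (volume.restrict (ball (0 : ι → ℝ) R)).map (fun p => (Ψ (v, p)).1) A) := by
              gcongr
          _ = (volume.restrict (ball (0 : ι → ℝ) R)).map (fun p => (Ψ (v, p)).1) A := by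
              rw [← mul_assoc, ENNReal.inv_mul_cancel hKc0 hKctop, one_mul]
      rw [Measure.map_smul, hbox, mul_smul]
      refine Measure.le_iff'.2 fun A => ?_
      have hA := Measure.le_iff'.1 h5 A
      simp only [Measure.smul_apply, smul_eq_mul] at hA ⊢
      gcongr

/-! ## §3 Exactness and uniform ergodicity -/

/-- **Exactness**: a measurable involution `Ψ` preserving `Haar^{⊗ι} ⊗ Lebesgue` (every `flip ∘ wordⁿ`
of a palindromic kick/drift word) gives a kernel leaving `π_S` invariant, for every measurable `S`
and `κ > 0`. -/
theorem u1Word_invariant_gibbsLaw {Ψ : Equiv.Perm ((ι → Circle) × (ι → ℝ))} (hΨ : Measurable ⇑Ψ)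
    (hκ : 0 < κ) (hinv : Function.Involutive ⇑Ψ)
    (hmp : MeasurePreserving ⇑Ψ ((Measure.pi fun _ : ι => haarProbability Circle).prod volume)
      ((Measure.pi fun _ : ι => haarProbability Circle).prod volume))
    {S : (ι → Circle) → ℝ} (hS : Measurable S) :
    Invariant (refreshUpdate (involMH _ hΨ fun z : (ι → Circle) × (ι → ℝ) => S z.1 + u1Kinetic κ z.2)
      (u1MomentumLaw κ)) (u1GibbsLaw S) :=
  invariant_smul (hmc_config_exact (vol := Measure.pi fun _ : ι => haarProbability Circle)
    (volP := volume) (hΦ := hΨ) hS (measurable_u1Kinetic κ) hinv hmp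
    (u1MomentumWeight_univ_ne_zero hκ) (u1MomentumWeight_univ_ne_top hκ)) _

/-- **UNIFORM ERGODICITY**: under the hypotheses of `u1Word_minorised` and invariance of `π_S`
(`u1Word_invariant_gibbsLaw`), there is `δ ∈ (0, 1]` with `|μ₀Kᵗ(A) − π_S(A)| ≤ (1 − δ)ᵗ` for
EVERY initial law `μ₀`, every `t`, every set `A`. -/
theorem u1Word_uniformlyErgodic {Ψ : Equiv.Perm ((ι → Circle) × (ι → ℝ))} (hΨ : Measurable ⇑Ψ)
    (hκ : 0 < κ) {a : ℝ} (ha : 0 < a) {lam : ℝ≥0} (hlam : (lam : ℝ) < a) {B₀ M : ℝ} (hM : 0 ≤ M)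
    (hfst : ∀ u, ∃ G : (ι → ℝ) → ι → ℝ, (∀ p, ‖G p‖ ≤ B₀) ∧ LipschitzWith lam G ∧
      ∀ p, (Ψ (u, p)).1 = u1ExpDrift 1 (a • p + G p) * u)
    (hsnd : ∀ u p, ‖(Ψ (u, p)).2‖ ≤ ‖p‖ + M)
    {S : (ι → Circle) → ℝ} (hS : Measurable S) {s : ℝ} (hs : ∀ u, |S u| ≤ s)
    (hinvS : Invariant (refreshUpdate (involMH _ hΨ fun z : (ι → Circle) × (ι → ℝ) =>
      S z.1 + u1Kinetic κ z.2) (u1MomentumLaw κ)) (u1GibbsLaw S)) :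
    ∃ δ : ℝ, 0 < δ ∧ δ ≤ 1 ∧ ∀ (μ₀ : Measure (ι → Circle)) [IsProbabilityMeasure μ₀] (t : ℕ)
      (A : Set (ι → Circle)),
      |((fun m : Measure (ι → Circle) => m.bind
          (refreshUpdate (involMH _ hΨ fun z : (ι → Circle) × (ι → ℝ) => S z.1 + u1Kinetic κ z.2)
            (u1MomentumLaw κ)))^[t] μ₀).real A - (u1GibbsLaw S).real A| ≤ (1 - δ) ^ t := by
  haveI : Fact (0 < κ) := ⟨hκ⟩
  haveI := isProbabilityMeasure_u1GibbsLaw (ι := ι) hs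
  obtain ⟨δ, hδ0, hmin⟩ := u1Word_minorised hΨ hκ ha hlam hM hfst hsnd hS hs
  have hH : Measurable fun z : (ι → Circle) × (ι → ℝ) => S z.1 + u1Kinetic κ z.2 :=
    (hS.comp measurable_fst).add ((measurable_u1Kinetic κ).comp measurable_snd)
  haveI : Fact (Measurable fun z : (ι → Circle) × (ι → ℝ) => S z.1 + u1Kinetic κ z.2) := ⟨hH⟩
  haveI : IsMarkovKernel (refreshUpdate (involMH _ hΨ fun z : (ι → Circle) × (ι → ℝ) =>
      S z.1 + u1Kinetic κ z.2) (u1MomentumLaw κ)) := by infer_instance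
  have hδ1 : δ ≤ 1 := by
    have h := Measure.le_iff'.1 (hmin fun _ => 1) univ
    rwa [Measure.smul_apply, smul_eq_mul, measure_univ, measure_univ, mul_one] at h
  have hδtop : δ ≠ ⊤ := ne_top_of_le_ne_top ENNReal.one_ne_top hδ1
  refine ⟨δ.toReal, ENNReal.toReal_pos hδ0.ne' hδtop,
    ENNReal.toReal_le_of_le_ofReal zero_le_one (by rwa [ENNReal.ofReal_one]), fun μ₀ _ t A => ?_⟩
  exact refreshUpdate_involMH_uniformlyErgodic hΨ hH (u1MomentumLaw κ) hmin hinvS μ₀ t A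

/-- **UNIQUENESS**: under the same hypotheses `π_S` is the only invariant probability law. -/
theorem u1Word_invariant_unique {Ψ : Equiv.Perm ((ι → Circle) × (ι → ℝ))} (hΨ : Measurable ⇑Ψ)
    (hκ : 0 < κ) {a : ℝ} (ha : 0 < a) {lam : ℝ≥0} (hlam : (lam : ℝ) < a) {B₀ M : ℝ} (hM : 0 ≤ M)
    (hfst : ∀ u, ∃ G : (ι → ℝ) → ι → ℝ, (∀ p, ‖G p‖ ≤ B₀) ∧ LipschitzWith lam G ∧
      ∀ p, (Ψ (u, p)).1 = u1ExpDrift 1 (a • p + G p) * u)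
    (hsnd : ∀ u p, ‖(Ψ (u, p)).2‖ ≤ ‖p‖ + M)
    {S : (ι → Circle) → ℝ} (hS : Measurable S) {s : ℝ} (hs : ∀ u, |S u| ≤ s)
    (hinvS : Invariant (refreshUpdate (involMH _ hΨ fun z : (ι → Circle) × (ι → ℝ) =>
      S z.1 + u1Kinetic κ z.2) (u1MomentumLaw κ)) (u1GibbsLaw S))
    {π' : Measure (ι → Circle)} [IsProbabilityMeasure π']
    (hπ' : Invariant (refreshUpdate (involMH _ hΨ fun z : (ι → Circle) × (ι → ℝ) =>
      S z.1 + u1Kinetic κ z.2) (u1MomentumLaw κ)) π') :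
    π' = u1GibbsLaw S := by
  haveI : Fact (0 < κ) := ⟨hκ⟩
  haveI := isProbabilityMeasure_u1GibbsLaw (ι := ι) hs
  obtain ⟨δ, hδ0, hmin⟩ := u1Word_minorised hΨ hκ ha hlam hM hfst hsnd hS hs
  have hH : Measurable fun z : (ι → Circle) × (ι → ℝ) => S z.1 + u1Kinetic κ z.2 :=
    (hS.comp measurable_fst).add ((measurable_u1Kinetic κ).comp measurable_snd)
  exact refreshUpdate_involMH_invariant_unique hΨ hH (u1MomentumLaw κ) hmin hδ0 hinvS hπ'

end Summit.Ventures.LatticeQCDFlow.Exactness
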